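import Literature.NumberTheory.Rogawski1990.WeylVanishingSplitTorusAxioms   -- ★ W-D docking: the vanishing theorem modulo conullity, `cm_*` bricks, `localSplitEquiv`
import Literature.MeasureTheory.Group.TranslateAveragingNull                  -- ★ the averaging lemma (Fubini both ways)
import Literature.NumberTheory.Automorphic.AdicCompletionCompact              -- ★ `properSpace_adicCompletion`
import HarnessLib

/-!
# The non-`G`-regular set of `H_v = U(Φ₂)(L⁺_v) × U(Φ₁)(L⁺_v)` is Haar-null at a split place, and the Weyl vanishing
# theorem for `H_v` (Harish-Chandra (1970), Lemma 42; Rogawski (1990), §12.5)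

Topic `NumberTheory/Rogawski1990`; namespace `Literature.NumberTheory.Rogawski1990`.  Theorems only (no definition, no named fact,
no instance, no `sorry`).  LAST BRICK of the road «W1s soft Weyl» (cell `pub/hodgecm-mathlib`, P3b line «CMCharIdentityTest», stub
`stub_weylVanishingSplit`): it discharges the one extra hypothesis `νH {a | IsLocalGRegular L v a}ᶜ = 0` of ★
`integral_eq_zero_of_forall_classOrbitalIntegral_eq_zero_of_conull` and states the stub's text as a theorem
(`integral_eq_zero_of_forall_classOrbitalIntegral_eq_zero_split`).

MATHEMATICS.  `v` split, `w ∣ v` with `c • w ≠ w`, `F = L_w`; ★ `localSplitEquiv` gives `e₂ : U(Φ₂)(L⁺_v) ≃ₜ* GL₂(F)`,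
`e₁ : U(Φ₁)(L⁺_v) ≃ₜ* GL₁(F)`.  `a = (a₂, a₁) ∈ H_v` is `G`-regular iff `χ(ι_v a) ∈ (Π_{w′∣v} L_{w′})[X]` is separable iff
(★ `separable_iff_forall_map_evalRingHom`) every `w′`-component `χ_{e₂′ a₂} · (X − ζ(e₁′ a₁))` is separable (§2, every `w′ ∣ v` is
split: `complexConj_smul_ne_of_exists`).  A product `p · (X − z)` over a field is separable as soon as `p` is separable and `p(z) ≠ 0`
(§0 `separable_mul_X_sub_C_of_not_isRoot`), so the non-regular set lies in the finite union over `w′` of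
`S₁ = {¬ χ_{e₂′a₂} separable}` and `S₂ = {χ_{e₂′a₂}(ζ(e₁′a₁)) = 0}`.  Both are null by the AVERAGING LEMMA ★
`measure_eq_zero_of_forall_finite_setOf_mul_mem` (right-invariance of `νH` + Fubini) along the split tori `s ↦ (e₂′⁻¹ diag(s, 1), 1)`
and `s ↦ (1, e₁′⁻¹ (s))`, parametrised by the additive Haar measure of `F` (atomless): along the first, `χ_{M·diag(s,1)}` is
non-separable only at the roots of the non-zero quadratic `M₀₀² s² + (2 M₀₀ M₁₁ − 4 det M) s + M₁₁²` (§0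
`finite_setOf_not_separable_charpoly_mul_diagonal`, char `≠ 2`; a monic quadratic with non-zero discriminant is separable by the
explicit Bézout identity `(p′)² − 4p = disc`); along the second, `χ_M(z s) = 0` has at most two solutions (§0 `finite_setOf_isRoot_mul`).
§1 packages the two averaging steps for ANY second-countable topological group `G` with continuous `π : G → M₂(F)`, `z : G → F`
and measurable torus maps `ι` (equivariance only off `s = 0`), so that §2 is pure transport along `e₂`, `e₁`.

HONEST LABEL: HC_CM is proved only modulo the 2 remaining named inputs (hLiu418, h413) until rung 0 closes; this file discharges no
named input of the summit — it closes the analytic brick (W1s) of the P3b line.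

## References
* [HarishChandra1970] Harish-Chandra (notes by G. van Dijk), *Harmonic analysis on reductive p-adic groups*, LNM 162 (1970), Lemma 42
  (Weyl integration formula; the regular set carries the Haar measure).
* [Rogawski1990] J. Rogawski, *Automorphic representations of unitary groups in three variables*, Ann. of Math. Stud. 123 (1990),
  §3.1 p. 19 (regular elements), §4.3 p. 42 (`ι_v`), §12.5 p. 182 (use of the Weyl formula on `H`).
* [WeilIntegration1965] A. Weil, *L'intégration dans les groupes topologiques*, 2e éd. (1965), §9.
-/

set_option autoImplicit false

noncomputable section

open MeasureTheory Measure Set Filter Topology NumberField IsDedekindDomain Polynomial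
open Literature.MeasureTheory.Group Literature.LinearAlgebra.Matrix
open scoped ENNReal NNReal Matrix MatrixGroups

namespace Literature.NumberTheory.Rogawski1990

/-! ## §0 Quadratic characteristic polynomials: separability off a finite set along a torus line -/

section MatrixLemmas

variable {K : Type*} [Field K]

/-- A `2 × 2` matrix whose discriminant `tr² − 4 det` is non-zero has separable characteristic polynomial (explicit Bézout identity
`(χ′)² − 4χ = tr² − 4 det`). [cite: Rogawski1990, §3.1 p. 19] -/
theorem charpoly_separable_of_trace_sq_sub_four_mul_det_ne_zero (M : Matrix (Fin 2) (Fin 2) K)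
    (h : M.trace ^ 2 - 4 * M.det ≠ 0) : M.charpoly.Separable := by
  rw [Matrix.charpoly_fin_two]
  set t := M.trace
  set d := M.det
  have hd : derivative (X ^ 2 - C t * X + C d) = C (2 : K) * X - C t := by
    simp only [derivative_add, derivative_sub, derivative_X_pow, derivative_mul, derivative_C, derivative_X, zero_mul,
      mul_one, zero_add, add_zero, map_ofNat, Nat.cast_ofNat]
    ring
  unfold Polynomial.Separable
  rw [hd]
  refine ⟨-4 * C (t ^ 2 - 4 * d)⁻¹, C (t ^ 2 - 4 * d)⁻¹ * (C (2 : K) * X - C t), ?_⟩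
  have key : -4 * C (t ^ 2 - 4 * d)⁻¹ * (X ^ 2 - C t * X + C d) + C (t ^ 2 - 4 * d)⁻¹ * (C (2 : K) * X - C t) * (C (2 : K) * X - C t) =
      C ((t ^ 2 - 4 * d)⁻¹ * (t ^ 2 - 4 * d)) := by
    simp only [map_mul, map_sub, map_pow, map_ofNat]
    ring
  rw [key, inv_mul_cancel₀ h, map_one]

/-- `p` separable and `p(c) ≠ 0` ⇒ `p · (X − c)` separable. [cite: Rogawski1990, §3.1 p. 19] -/
theorem separable_mul_X_sub_C_of_not_isRoot {p : K[X]} (hp : p.Separable) {c : K} (hc : ¬ p.IsRoot c) :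
    (p * (X - C c)).Separable :=
  hp.mul (separable_X_sub_C) (((irreducible_X_sub_C c).coprime_iff_not_dvd.2 (by rwa [dvd_iff_isRoot])).symm)

/-- Contrapositive: if `p · (X − c)` is not separable then `p` is not separable or `p(c) = 0`. [cite: Rogawski1990, §3.1 p. 19] -/
theorem not_separable_or_isRoot_of_not_separable_mul_X_sub_C {p : K[X]} {c : K} (h : ¬ (p * (X - C c)).Separable) :
    ¬ p.Separable ∨ p.IsRoot c := by
  by_contra h'
  rw [not_or, not_not] at h'
  exact h (separable_mul_X_sub_C_of_not_isRoot h'.1 h'.2)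

/-- `{u | p(z u) = 0}` is finite for `p ≠ 0`, `z ≠ 0`. [cite: HarishChandra1970, Lemma 42] -/
theorem finite_setOf_isRoot_mul (p : K[X]) (hp : p ≠ 0) {z : K} (hz : z ≠ 0) : {u : K | p.IsRoot (z * u)}.Finite :=
  (finite_setOf_isRoot hp).preimage (mul_right_injective₀ hz).injOn

/-- **Along the torus line `u ↦ M · diag(u, 1)` (`det M ≠ 0`, char `≠ 2`) the characteristic polynomial is non-separable only for
finitely many `u`**: non-separability forces the discriminant `(M₀₀ u + M₁₁)² − 4 det(M) u` to vanish, a non-zero quadratic in `u`.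
[cite: HarishChandra1970, Lemma 42] -/
theorem finite_setOf_not_separable_charpoly_mul_diagonal [NeZero (2 : K)] (M : Matrix (Fin 2) (Fin 2) K) (hM : M.det ≠ 0) :
    {u : K | ¬ (M * Matrix.diagonal ![u, 1]).charpoly.Separable}.Finite := by
  set Q : K[X] := C (M 0 0 ^ 2) * X ^ 2 + C (2 * M 0 0 * M 1 1 - 4 * M.det) * X + C (M 1 1 ^ 2) with hQ
  have hQ0 : Q ≠ 0 := by
    intro h0
    by_cases h00 : M 0 0 = 0
    · have h1 := congrArg (fun q : K[X] => q.coeff 1) h0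
      simp only [hQ, h00, coeff_add, coeff_C_mul, coeff_X_pow, coeff_X_one, coeff_C, coeff_zero] at h1
      norm_num at h1
      have h4 : (4 : K) ≠ 0 := by
        have : (4 : K) = 2 * 2 := by norm_num
        rw [this]; exact mul_ne_zero two_ne_zero two_ne_zero
      exact hM (h1.resolve_left h4)
    · have h2 := congrArg (fun q : K[X] => q.coeff 2) h0
      simp only [hQ, coeff_add, coeff_C_mul, coeff_X_pow, coeff_X, coeff_C, coeff_zero] at h2
      norm_num at h2
      exact h00 h2
  refine (finite_setOf_isRoot hQ0).subset fun u hu => ?_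
  simp only [Set.mem_setOf_eq] at hu ⊢
  by_contra hne
  apply hu
  apply charpoly_separable_of_trace_sq_sub_four_mul_det_ne_zero
  intro h0
  apply hne
  rw [IsRoot.def]
  rw [← h0, hQ]
  simp only [eval_add, eval_mul, eval_C, eval_pow, eval_X, Matrix.trace_fin_two, Matrix.mul_diagonal, Matrix.det_mul,
    Matrix.det_diagonal, Fin.prod_univ_two, Matrix.cons_val_zero, Matrix.cons_val_one]
  ring

/-- `χ_M(z) = 0 ⟺ z² − tr(M) z + det M = 0` for a `2 × 2` matrix. [cite: Rogawski1990, §3.1 p. 19] -/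
theorem isRoot_charpoly_two_iff (M : Matrix (Fin 2) (Fin 2) K) (z : K) :
    M.charpoly.IsRoot z ↔ z ^ 2 - M.trace * z + M.det = 0 := by
  rw [IsRoot.def, Matrix.charpoly_fin_two]
  simp only [eval_add, eval_sub, eval_mul, eval_pow, eval_C, eval_X, mul_comm (M.trace)]

end MatrixLemmas

/-! ## §1 Averaging along split tori in a topological group -/

section Torus

variable {F : Type*} [NontriviallyNormedField F]

/-- Inversion is continuous on the punctured line (as a map on the subtype). [cite: WeilIntegration1965, §9] -/
theorem continuous_inv_subtype_ne_zero : Continuous fun x : {s : F // s ≠ 0} => (x : F)⁻¹ :=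
  continuousOn_inv₀.comp_continuous continuous_subtype_val fun x => x.2

/-- The split torus `s ↦ diag(s, 1) : F^× → GL₂(F)` (as an explicit unit) is continuous. [cite: WeilIntegration1965, §9] -/
theorem continuous_diagUnit_two :
    Continuous (fun x : {s : F // s ≠ 0} => (⟨Matrix.diagonal ![(x : F), 1], Matrix.diagonal ![(x : F)⁻¹, 1],
      by rw [Matrix.diagonal_mul_diagonal, ← Matrix.diagonal_one]; congr 1; funext i; fin_cases i <;> simp [x.2],
      by rw [Matrix.diagonal_mul_diagonal, ← Matrix.diagonal_one]; congr 1; funext i; fin_cases i <;> simp [x.2]⟩ : GL (Fin 2) F)) := by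
  refine Units.continuous_iff.2 ⟨?_, ?_⟩
  · refine Continuous.matrix_diagonal (continuous_pi fun i => ?_)
    fin_cases i
    · simpa using continuous_subtype_val
    · simpa using continuous_const
  · refine Continuous.matrix_diagonal (continuous_pi fun i => ?_)
    fin_cases i
    · simpa using (continuous_inv_subtype_ne_zero (F := F))
    · simpa using continuous_const

/-- The torus `s ↦ (s) : F^× → GL₁(F)` (as an explicit unit) is continuous. [cite: WeilIntegration1965, §9] -/
theorem continuous_diagUnit_one :
    Continuous (fun x : {s : F // s ≠ 0} => (⟨Matrix.diagonal ![(x : F)], Matrix.diagonal ![(x : F)⁻¹],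
      by rw [Matrix.diagonal_mul_diagonal, ← Matrix.diagonal_one]; congr 1; funext i; fin_cases i; simp [x.2],
      by rw [Matrix.diagonal_mul_diagonal, ← Matrix.diagonal_one]; congr 1; funext i; fin_cases i; simp [x.2]⟩ : GL (Fin 1) F)) := by
  refine Units.continuous_iff.2 ⟨?_, ?_⟩
  · refine Continuous.matrix_diagonal (continuous_pi fun i => ?_)
    fin_cases i
    simpa using continuous_subtype_val
  · refine Continuous.matrix_diagonal (continuous_pi fun i => ?_)
    fin_cases i
    simpa using (continuous_inv_subtype_ne_zero (F := F))

variable [MeasurableSpace F] [BorelSpace F] {G : Type*} [TopologicalSpace G] [MeasurableSpace G] [BorelSpace G]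

/-- A map `φ : F → G` that agrees off `0` with a continuous map on the punctured line is measurable. [cite: WeilIntegration1965, §9] -/
theorem measurable_of_eq_on_ne_zero {f : {s : F // s ≠ 0} → G} (hf : Continuous f) (φ : F → G)
    (hφ : ∀ (s : F) (h : s ≠ 0), φ s = f ⟨s, h⟩) : Measurable φ := by
  refine measurable_of_measurable_on_compl_singleton (0 : F) ?_
  have : ({x : F | x ≠ 0}.restrict φ) = fun x => f ⟨x.1, x.2⟩ := by
    funext x
    exact hφ x.1 x.2
  rw [this]
  exact hf.measurable

variable [ProperSpace F] [Group G] [IsTopologicalGroup G] [SecondCountableTopology G]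

/-- **Torus averaging, I.**  `G` a second-countable topological group, `ν` right-invariant s-finite, `π : G → M₂(F)` continuous with
invertible values, `ι : F → G` measurable with `π(g · ι(s)) = π(g) · diag(s, 1)` for `s ≠ 0` (`F` a proper non-trivially normed field of
characteristic `≠ 2`): **`{g | χ_{π g} not separable}` is `ν`-null** (averaging lemma over the additive Haar measure of `F`, fibres finite
by `finite_setOf_not_separable_charpoly_mul_diagonal`). [cite: HarishChandra1970, Lemma 42] [cite: WeilIntegration1965, §9] -/
theorem measure_setOf_not_separable_charpoly_eq_zero [NeZero (2 : F)] (π : G → Matrix (Fin 2) (Fin 2) F) (hπ : Continuous π)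
    (hdet : ∀ g, (π g).det ≠ 0) (ι : F → G) (hιm : Measurable ι)
    (hι : ∀ g (s : F), s ≠ 0 → π (g * ι s) = π g * Matrix.diagonal ![s, 1])
    (ν : Measure G) [SFinite ν] [ν.IsMulRightInvariant] : ν {g | ¬ (π g).charpoly.Separable} = 0 := by
  have hS : MeasurableSet {g | ¬ (π g).charpoly.Separable} :=
    ((isOpen_setOf_charpoly_separable (E := F) (n := Fin 2)).preimage hπ).measurableSet.compl
  have hμ : (Measure.addHaar : Measure F) ≠ 0 :=
    Measure.measure_univ_ne_zero.mp (IsOpen.measure_ne_zero _ isOpen_univ univ_nonempty)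
  refine measure_eq_zero_of_forall_finite_setOf_mul_mem ν (Measure.addHaar : Measure F) hμ hιm hS fun g => ?_
  refine ((Set.finite_singleton (0 : F)).union (finite_setOf_not_separable_charpoly_mul_diagonal (π g) (hdet g))).subset
    fun s hs => ?_
  by_cases h0 : s = 0
  · exact Or.inl h0
  · right
    simp only [Set.mem_setOf_eq] at hs ⊢
    rwa [hι g s h0] at hs

/-- **Torus averaging, II.**  With `π : G → M₂(F)`, `z : G → F^×` continuous and `ι : F → G` measurable with `π(g · ι(s)) = π(g)`,
`z(g · ι(s)) = z(g) · s` for `s ≠ 0`: **`{g | χ_{π g}(z g) = 0}` is `ν`-null** (fibres finite by `finite_setOf_isRoot_mul`).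
[cite: HarishChandra1970, Lemma 42] [cite: WeilIntegration1965, §9] -/
theorem measure_setOf_isRoot_charpoly_eq_zero (π : G → Matrix (Fin 2) (Fin 2) F) (hπ : Continuous π)
    (z : G → F) (hz : Continuous z) (hz0 : ∀ g, z g ≠ 0) (ι : F → G) (hιm : Measurable ι)
    (hιπ : ∀ g (s : F), s ≠ 0 → π (g * ι s) = π g) (hιz : ∀ g (s : F), s ≠ 0 → z (g * ι s) = z g * s)
    (ν : Measure G) [SFinite ν] [ν.IsMulRightInvariant] : ν {g | (π g).charpoly.IsRoot (z g)} = 0 := by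
  have hset : {g | (π g).charpoly.IsRoot (z g)} = (fun g => z g ^ 2 - (π g).trace * z g + (π g).det) ⁻¹' {0} := by
    ext g
    simp only [Set.mem_setOf_eq, Set.mem_preimage, Set.mem_singleton_iff, isRoot_charpoly_two_iff]
  have hS : MeasurableSet {g | (π g).charpoly.IsRoot (z g)} := by
    rw [hset]
    exact (isClosed_singleton.preimage (((hz.pow 2).sub (hπ.matrix_trace.mul hz)).add hπ.matrix_det)).measurableSet
  have hμ : (Measure.addHaar : Measure F) ≠ 0 :=
    Measure.measure_univ_ne_zero.mp (IsOpen.measure_ne_zero _ isOpen_univ univ_nonempty)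
  refine measure_eq_zero_of_forall_finite_setOf_mul_mem ν (Measure.addHaar : Measure F) hμ hιm hS fun g => ?_
  refine ((Set.finite_singleton (0 : F)).union
    (finite_setOf_isRoot_mul (π g).charpoly (Matrix.charpoly_monic _).ne_zero (hz0 g))).subset fun s hs => ?_
  by_cases h0 : s = 0
  · exact Or.inl h0
  · right
    simp only [Set.mem_setOf_eq] at hs ⊢
    rwa [hιπ g s h0, hιz g s h0] at hs

end Torus

/-! ## §2 `H_v` at a split place: the non-`G`-regular set is null; the Weyl vanishing theorem -/

open Literature.NumberTheory.Automorphic Literature.NumberTheory.Automorphic.UnitaryGroup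

section CMH

variable (L : Type) [Field L] [NumberField L] [IsCMField L] (v : HeightOneSpectrum (𝓞 ↥(maximalRealSubfield L)))

/-- At a split place EVERY `w′ ∣ v` has `c • w′ ≠ w′` (the places over `v` are `w` and `c⁻¹ • w`, ★ `PlacesOver.eq_or_eq_galInv`).
[cite: Rogawski1990, §3.1 p. 19] -/
theorem complexConj_smul_ne_of_exists (hs : ∃ w : PlacesOver L v, IsCMField.complexConj L • w.1 ≠ w.1) (w' : PlacesOver L v) :
    IsCMField.complexConj L • w'.1 ≠ w'.1 := by
  obtain ⟨w, hw⟩ := hs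
  rcases PlacesOver.eq_or_eq_galInv (IsCMField.complexConj L) (IsCMField.complexConj_ne_one L) w w' with rfl | h
  · exact hw
  · rw [h]
    intro h'
    apply PlacesOver.galInv_ne (IsCMField.complexConj L) w hw
    apply Subtype.ext
    change IsCMField.complexConj L • (IsCMField.complexConj L)⁻¹ • w.1 = (IsCMField.complexConj L)⁻¹ • w.1 at h'
    rw [smul_inv_smul] at h'
    exact h'.symm

set_option maxHeartbeats 800000 in
set_option synthInstance.maxHeartbeats 200000 in
/-- **At a split place, the set of `a ∈ H_v` whose `w`-component characteristic polynomial `χ_{e₂ a₂} · (X − ζ(e₁ a₁))` is NOT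
separable is Haar-null** (`νH` right-invariant, s-finite): it lies in `{χ_{e₂a₂} not separable} ∪ {χ_{e₂a₂}(ζ(e₁a₁)) = 0}`, null by
torus averaging I∕II along `s ↦ (e₂⁻¹ diag(s,1), 1)` and `s ↦ (1, e₁⁻¹(s))`. [cite: HarishChandra1970, Lemma 42] [cite: Rogawski1990, §4.3 p. 42] -/
theorem measure_setOf_not_separable_map_charpoly_endoEmbLocal_eq_zero (w : PlacesOver L v) (hw : IsCMField.complexConj L • w.1 ≠ w.1)
    [MeasurableSpace ((UnitaryGroup.cmDatum L 2 (Matrix.of fun i j : Fin 2 => if i.val + j.val + 1 = 2 then (1 : L) else 0)).Local v × (UnitaryGroup.cmDatum L 1 (Matrix.of fun i j : Fin 1 => if i.val + j.val + 1 = 1 then (1 : L) else 0)).Local v)] [BorelSpace ((UnitaryGroup.cmDatum L 2 (Matrix.of fun i j : Fin 2 => if i.val + j.val + 1 = 2 then (1 : L) else 0)).Local v × (UnitaryGroup.cmDatum L 1 (Matrix.of fun i j : Fin 1 => if i.val + j.val + 1 = 1 then (1 : L) else 0)).Local v)] (νH : Measure ((UnitaryGroup.cmDatum L 2 (Matrix.of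 fun i j : Fin 2 => if i.val + j.val + 1 = 2 then (1 : L) else 0)).Local v × (UnitaryGroup.cmDatum L 1 (Matrix.of fun i j : Fin 1 => if i.val + j.val + 1 = 1 then (1 : L) else 0)).Local v)) [SFinite νH] [νH.IsMulRightInvariant] :
    νH {a : ((UnitaryGroup.cmDatum L 2 (Matrix.of fun i j : Fin 2 => if i.val + j.val + 1 = 2 then (1 : L) else 0)).Local v × (UnitaryGroup.cmDatum L 1 (Matrix.of fun i j : Fin 1 => if i.val + j.val + 1 = 1 then (1 : L) else 0)).Local v) | ¬ (((((endoEmbLocal L v a).val : GL (Fin 3) (UnitaryGroup.LocalRing L v)) : Matrix (Fin 3) (Fin 3) (UnitaryGroup.LocalRing L v)).charpoly).map (Pi.evalRingHom (fun w' : PlacesOver L v => w'.1.adicCompletion L) w)).Separable} = 0 := by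
  classical
  letI : NontriviallyNormedField (w.1.adicCompletion L) :=
    Valued.toNontriviallyNormedField (w.1.adicCompletion L) (WithZero (Multiplicative ℤ))
  haveI : CharZero (w.1.adicCompletion L) := charZero_of_injective_algebraMap (algebraMap L _).injective
  haveI : NeZero (2 : w.1.adicCompletion L) := inferInstance
  haveI : ProperSpace (w.1.adicCompletion L) := properSpace_adicCompletion L w.1
  letI : MeasurableSpace (w.1.adicCompletion L) := borel _
  haveI : BorelSpace (w.1.adicCompletion L) := ⟨rfl⟩
  let e₂ : (UnitaryGroup.cmDatum L 2 (Matrix.of fun i j : Fin 2 => if i.val + j.val + 1 = 2 then (1 : L) else 0)).Local v ≃ₜ* GL (Fin 2) (w.1.adicCompletion L) :=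
    localSplitEquiv (IsCMField.complexConj L) _ (IsCMField.complexConj_ne_one L) (cm_antidiagTwo_map_transpose L) w hw
      (isUnit_placeForm_of_isUnit_det (cm_isUnit_det_antidiagTwo L) w.1)
  let e₁ : (UnitaryGroup.cmDatum L 1 (Matrix.of fun i j : Fin 1 => if i.val + j.val + 1 = 1 then (1 : L) else 0)).Local v ≃ₜ* GL (Fin 1) (w.1.adicCompletion L) :=
    localSplitEquiv (IsCMField.complexConj L) _ (IsCMField.complexConj_ne_one L) (cm_antidiagOne_map_transpose L) w hw
      (isUnit_placeForm_of_isUnit_det (cm_isUnit_det_antidiagOne L) w.1)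
  -- the two continuous invariants `π a = e₂ a₂` (as a matrix) and `z a = ζ(e₁ a₁)`
  let π : ((UnitaryGroup.cmDatum L 2 (Matrix.of fun i j : Fin 2 => if i.val + j.val + 1 = 2 then (1 : L) else 0)).Local v × (UnitaryGroup.cmDatum L 1 (Matrix.of fun i j : Fin 1 => if i.val + j.val + 1 = 1 then (1 : L) else 0)).Local v) → Matrix (Fin 2) (Fin 2) (w.1.adicCompletion L) := fun a =>
    ((e₂ a.1 : GL (Fin 2) (w.1.adicCompletion L)) : Matrix (Fin 2) (Fin 2) (w.1.adicCompletion L))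
  let z : ((UnitaryGroup.cmDatum L 2 (Matrix.of fun i j : Fin 2 => if i.val + j.val + 1 = 2 then (1 : L) else 0)).Local v × (UnitaryGroup.cmDatum L 1 (Matrix.of fun i j : Fin 1 => if i.val + j.val + 1 = 1 then (1 : L) else 0)).Local v) → w.1.adicCompletion L := fun a =>
    ((e₁ a.2 : GL (Fin 1) (w.1.adicCompletion L)) : Matrix (Fin 1) (Fin 1) (w.1.adicCompletion L)) 0 0
  have hπ : Continuous π := Units.continuous_val.comp (e₂.continuous.comp continuous_fst)
  have hz : Continuous z := (Units.continuous_val.comp (e₁.continuous.comp continuous_snd)).matrix_elem 0 0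
  have hdet : ∀ a, (π a).det ≠ 0 := fun a => ((Matrix.isUnit_iff_isUnit_det _).mp (e₂ a.1).isUnit).ne_zero
  have hz0 : ∀ a, z a ≠ 0 := fun a => by
    have h := ((Matrix.isUnit_iff_isUnit_det _).mp (e₁ a.2).isUnit).ne_zero
    rwa [Matrix.det_fin_one] at h
  -- the `w`-component of `χ(ι_v a)` is `χ_{π a} · (X − z a)`
  have hchar : ∀ a : ((UnitaryGroup.cmDatum L 2 (Matrix.of fun i j : Fin 2 => if i.val + j.val + 1 = 2 then (1 : L) else 0)).Local v × (UnitaryGroup.cmDatum L 1 (Matrix.of fun i j : Fin 1 => if i.val + j.val + 1 = 1 then (1 : L) else 0)).Local v), ((((endoEmbLocal L v a).val : GL (Fin 3) (UnitaryGroup.LocalRing L v)) : Matrix (Fin 3) (Fin 3) (UnitaryGroup.LocalRing L v)).charpoly).map (Pi.evalRingHom (fun w' : PlacesOver L v => w'.1.adicCompletion L) w) = (π a).charpoly * (X - C (z a)) := by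
    intro a
    rw [coe_endoEmbLocal, charpoly_endoGL, Polynomial.map_mul, ← Matrix.charpoly_map, ← Matrix.charpoly_map]
    congr 1
    rw [Matrix.charpoly, Matrix.det_fin_one, Matrix.charmatrix_apply_eq]
    rfl
  have hsub : {a : ((UnitaryGroup.cmDatum L 2 (Matrix.of fun i j : Fin 2 => if i.val + j.val + 1 = 2 then (1 : L) else 0)).Local v × (UnitaryGroup.cmDatum L 1 (Matrix.of fun i j : Fin 1 => if i.val + j.val + 1 = 1 then (1 : L) else 0)).Local v) | ¬ (((((endoEmbLocal L v a).val : GL (Fin 3) (UnitaryGroup.LocalRing L v)) : Matrix (Fin 3) (Fin 3) (UnitaryGroup.LocalRing L v)).charpoly).map (Pi.evalRingHom (fun w' : PlacesOver L v => w'.1.adicCompletion L) w)).Separable} ⊆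
      {a | ¬ (π a).charpoly.Separable} ∪ {a | (π a).charpoly.IsRoot (z a)} := by
    intro a ha
    simp only [Set.mem_setOf_eq] at ha
    rw [hchar a] at ha
    exact not_separable_or_isRoot_of_not_separable_mul_X_sub_C ha
  -- torus I: `s ↦ (e₂⁻¹ diag(s, 1), 1)`
  let D₂ : {s : w.1.adicCompletion L // s ≠ 0} → GL (Fin 2) (w.1.adicCompletion L) := fun x =>
    ⟨Matrix.diagonal ![(x : w.1.adicCompletion L), 1], Matrix.diagonal ![(x : w.1.adicCompletion L)⁻¹, 1],
      by rw [Matrix.diagonal_mul_diagonal, ← Matrix.diagonal_one]; congr 1; funext i; fin_cases i <;> simp [x.2],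
      by rw [Matrix.diagonal_mul_diagonal, ← Matrix.diagonal_one]; congr 1; funext i; fin_cases i <;> simp [x.2]⟩
  let ι₂ : w.1.adicCompletion L → ((UnitaryGroup.cmDatum L 2 (Matrix.of fun i j : Fin 2 => if i.val + j.val + 1 = 2 then (1 : L) else 0)).Local v × (UnitaryGroup.cmDatum L 1 (Matrix.of fun i j : Fin 1 => if i.val + j.val + 1 = 1 then (1 : L) else 0)).Local v) := fun s => if h : s = 0 then 1 else (e₂.symm (D₂ ⟨s, h⟩), 1)
  have hι₂m : Measurable ι₂ :=
    measurable_of_eq_on_ne_zero (f := fun x => (e₂.symm (D₂ x), (1 : (UnitaryGroup.cmDatum L 1 (Matrix.of fun i j : Fin 1 => if i.val + j.val + 1 = 1 then (1 : L) else 0)).Local v)))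
      ((e₂.symm.continuous.comp continuous_diagUnit_two).prodMk continuous_const) ι₂ (fun s h => dif_neg h)
  have hι₂ : ∀ (a : ((UnitaryGroup.cmDatum L 2 (Matrix.of fun i j : Fin 2 => if i.val + j.val + 1 = 2 then (1 : L) else 0)).Local v × (UnitaryGroup.cmDatum L 1 (Matrix.of fun i j : Fin 1 => if i.val + j.val + 1 = 1 then (1 : L) else 0)).Local v)) (s : w.1.adicCompletion L), s ≠ 0 → π (a * ι₂ s) = π a * Matrix.diagonal ![s, 1] := by
    intro a s h
    simp only [π, ι₂, dif_neg h, Prod.fst_mul, map_mul, ContinuousMulEquiv.apply_symm_apply, Units.val_mul, D₂]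
  have h1 : νH {a | ¬ (π a).charpoly.Separable} = 0 :=
    measure_setOf_not_separable_charpoly_eq_zero π hπ hdet ι₂ hι₂m hι₂ νH
  -- torus II: `s ↦ (1, e₁⁻¹ (s))`
  let D₁ : {s : w.1.adicCompletion L // s ≠ 0} → GL (Fin 1) (w.1.adicCompletion L) := fun x =>
    ⟨Matrix.diagonal ![(x : w.1.adicCompletion L)], Matrix.diagonal ![(x : w.1.adicCompletion L)⁻¹],
      by rw [Matrix.diagonal_mul_diagonal, ← Matrix.diagonal_one]; congr 1; funext i; fin_cases i; simp [x.2],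
      by rw [Matrix.diagonal_mul_diagonal, ← Matrix.diagonal_one]; congr 1; funext i; fin_cases i; simp [x.2]⟩
  let ι₁ : w.1.adicCompletion L → ((UnitaryGroup.cmDatum L 2 (Matrix.of fun i j : Fin 2 => if i.val + j.val + 1 = 2 then (1 : L) else 0)).Local v × (UnitaryGroup.cmDatum L 1 (Matrix.of fun i j : Fin 1 => if i.val + j.val + 1 = 1 then (1 : L) else 0)).Local v) := fun s => if h : s = 0 then 1 else (1, e₁.symm (D₁ ⟨s, h⟩))
  have hι₁m : Measurable ι₁ :=
    measurable_of_eq_on_ne_zero (f := fun x => ((1 : (UnitaryGroup.cmDatum L 2 (Matrix.of fun i j : Fin 2 => if i.val + j.val + 1 = 2 then (1 : L) else 0)).Local v), e₁.symm (D₁ x)))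
      (continuous_const.prodMk (e₁.symm.continuous.comp continuous_diagUnit_one)) ι₁ (fun s h => dif_neg h)
  have hι₁π : ∀ (a : ((UnitaryGroup.cmDatum L 2 (Matrix.of fun i j : Fin 2 => if i.val + j.val + 1 = 2 then (1 : L) else 0)).Local v × (UnitaryGroup.cmDatum L 1 (Matrix.of fun i j : Fin 1 => if i.val + j.val + 1 = 1 then (1 : L) else 0)).Local v)) (s : w.1.adicCompletion L), s ≠ 0 → π (a * ι₁ s) = π a := by
    intro a s h
    simp only [π, ι₁, dif_neg h, Prod.fst_mul, mul_one]
  have hι₁z : ∀ (a : ((UnitaryGroup.cmDatum L 2 (Matrix.of fun i j : Fin 2 => if i.val + j.val + 1 = 2 then (1 : L) else 0)).Local v × (UnitaryGroup.cmDatum L 1 (Matrix.of fun i j : Fin 1 => if i.val + j.val + 1 = 1 then (1 : L) else 0)).Local v)) (s : w.1.adicCompletion L), s ≠ 0 → z (a * ι₁ s) = z a * s := by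
    intro a s h
    simp only [z, ι₁, dif_neg h, Prod.snd_mul, map_mul, ContinuousMulEquiv.apply_symm_apply, Units.val_mul, D₁,
      Matrix.mul_diagonal, Matrix.cons_val_fin_one]
  have h2 : νH {a | (π a).charpoly.IsRoot (z a)} = 0 :=
    measure_setOf_isRoot_charpoly_eq_zero π hπ z hz hz0 ι₁ hι₁m hι₁π hι₁z νH
  exact measure_mono_null hsub (measure_union_null h1 h2)

/-- **CONULLITY OF THE `G`-REGULAR SET.**  At a place `v` of `L⁺` split in `L`, for any right-invariant s-finite Borel measure `νH` on
`H_v = U(Φ₂)(L⁺_v) × U(Φ₁)(L⁺_v)` (e.g. a Haar measure): `νH {a | IsLocalGRegular L v a}ᶜ = 0` — the non-regular set is the finite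
union over `w′ ∣ v` of the sets of the previous theorem (★ `separable_iff_forall_map_evalRingHom`). [cite: HarishChandra1970, Lemma 42]
[cite: Rogawski1990, §4.3 p. 42] -/
theorem measure_compl_setOf_isLocalGRegular_eq_zero (hs : ∃ w : PlacesOver L v, IsCMField.complexConj L • w.1 ≠ w.1)
    [MeasurableSpace ((UnitaryGroup.cmDatum L 2 (Matrix.of fun i j : Fin 2 => if i.val + j.val + 1 = 2 then (1 : L) else 0)).Local v × (UnitaryGroup.cmDatum L 1 (Matrix.of fun i j : Fin 1 => if i.val + j.val + 1 = 1 then (1 : L) else 0)).Local v)] [BorelSpace ((UnitaryGroup.cmDatum L 2 (Matrix.of fun i j : Fin 2 => if i.val + j.val + 1 = 2 then (1 : L) else 0)).Local v × (UnitaryGroup.cmDatum L 1 (Matrix.of fun i j : Fin 1 => if i.val + j.val + 1 = 1 then (1 : L) else 0)).Local v)] (νH : Measure ((UnitaryGroup.cmDatum L 2 (Matrix.of fun i j : Fin 2 => if i.val + j.val + 1 = 2 then (1 : L) else 0)).Local v × (UnitaryGroup.cmDatum L 1 (Matrix.of fun i j : Fin 1 => if i.val + j.val + 1 = 1 then (1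 : L) else 0)).Local v)) [SFinite νH] [νH.IsMulRightInvariant] :
    νH {a : ((UnitaryGroup.cmDatum L 2 (Matrix.of fun i j : Fin 2 => if i.val + j.val + 1 = 2 then (1 : L) else 0)).Local v × (UnitaryGroup.cmDatum L 1 (Matrix.of fun i j : Fin 1 => if i.val + j.val + 1 = 1 then (1 : L) else 0)).Local v) | IsLocalGRegular L v a}ᶜ = 0 := by
  classical
  have hsub : {a : ((UnitaryGroup.cmDatum L 2 (Matrix.of fun i j : Fin 2 => if i.val + j.val + 1 = 2 then (1 : L) else 0)).Local v × (UnitaryGroup.cmDatum L 1 (Matrix.of fun i j : Fin 1 => if i.val + j.val + 1 = 1 then (1 : L) else 0)).Local v) | IsLocalGRegular L v a}ᶜ ⊆ ⋃ w' : PlacesOver L v, {a : ((UnitaryGroup.cmDatum L 2 (Matrix.of fun i j : Fin 2 => if i.val + j.val + 1 = 2 then (1 : L) else 0)).Local v × (UnitaryGroup.cmDatum L 1 (Matrix.of fun i j : Fin 1 => if i.val + j.val + 1 = 1 then (1 : L) else 0)).Local v) | ¬ (((((endoEmbLocal L v a).val : GL (Fin 3) (UnitaryGroup.LocalRing L v))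 : Matrix (Fin 3) (Fin 3) (UnitaryGroup.LocalRing L v)).charpoly).map (Pi.evalRingHom (fun w'' : PlacesOver L v => w''.1.adicCompletion L) w')).Separable} := by
    intro a ha
    rw [Set.mem_compl_iff, Set.mem_setOf_eq] at ha
    have key : IsLocalGRegular L v a ↔ IsRegularElt ((endoEmbLocal L v a).val : GL (Fin 3) (UnitaryGroup.LocalRing L v)) := Iff.rfl
    rw [key, isRegularElt_iff, Literature.Algebra.Polynomial.separable_iff_forall_map_evalRingHom, not_forall] at ha
    obtain ⟨w', hw'⟩ := ha
    exact Set.mem_iUnion.2 ⟨w', hw'⟩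
  exact measure_mono_null hsub (measure_iUnion_null fun w' =>
    measure_setOf_not_separable_map_charpoly_endoEmbLocal_eq_zero L v w' (complexConj_smul_ne_of_exists L v hs w') νH)

set_option synthInstance.maxHeartbeats 200000 in
/-- **W1s — THE WEYL VANISHING THEOREM FOR `H_v` AT A SPLIT PLACE** (the statement of the P3b stub `stub_weylVanishingSplit`).  At a
place `v` of `L⁺` split in `L`, for a Haar measure `νH` on `H_v`, a CANONICAL orbital measure family `mH` for the `G`-regular classes
and a test function `g` (locally constant, compactly supported) all of whose `G`-regular class orbital integrals vanish: `∫ g dνH = 0`.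
★ `integral_eq_zero_of_forall_classOrbitalIntegral_eq_zero_of_conull` + `measure_compl_setOf_isLocalGRegular_eq_zero`.
[cite: HarishChandra1970, Lemma 42] [cite: Rogawski1990, §12.5 p. 182] -/
theorem integral_eq_zero_of_forall_classOrbitalIntegral_eq_zero_split
    (hs : ∃ w : PlacesOver L v, IsCMField.complexConj L • w.1 ≠ w.1)
    [MeasurableSpace ((UnitaryGroup.cmDatum L 2 (Matrix.of fun i j : Fin 2 => if i.val + j.val + 1 = 2 then (1 : L) else 0)).Local v × (UnitaryGroup.cmDatum L 1 (Matrix.of fun i j : Fin 1 => if i.val + j.val + 1 = 1 then (1 : L) else 0)).Local v)] [BorelSpace ((UnitaryGroup.cmDatum L 2 (Matrix.of fun i j : Fin 2 => if i.val + j.val + 1 = 2 then (1 : L) else 0)).Local v × (UnitaryGroup.cmDatum L 1 (Matrix.of fun i j : Fin 1 => if i.val + j.val + 1 = 1 then (1 : L) else 0)).Local v)] (νH : Measure ((UnitaryGroup.cmDatum L 2 (Matrix.of fun i j : Fin 2 => if i.val + j.val + 1 = 2 then (1 : L) else 0)).Local v × (UnitaryGroup.cmDatum L 1 (Matrix.of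 fun i j : Fin 1 => if i.val + j.val + 1 = 1 then (1 : L) else 0)).Local v)) [νH.IsHaarMeasure] [νH.IsMulRightInvariant]
    [∀ a : ((UnitaryGroup.cmDatum L 2 (Matrix.of fun i j : Fin 2 => if i.val + j.val + 1 = 2 then (1 : L) else 0)).Local v × (UnitaryGroup.cmDatum L 1 (Matrix.of fun i j : Fin 1 => if i.val + j.val + 1 = 1 then (1 : L) else 0)).Local v), MeasurableSpace (((UnitaryGroup.cmDatum L 2 (Matrix.of fun i j : Fin 2 => if i.val + j.val + 1 = 2 then (1 : L) else 0)).Local v × (UnitaryGroup.cmDatum L 1 (Matrix.of fun i j : Fin 1 => if i.val + j.val + 1 = 1 then (1 : L) else 0)).Local v) ⧸ Subgroup.centralizer ({a} : Set ((UnitaryGroup.cmDatum L 2 (Matrix.of fun i j : Fin 2 => if i.val + j.val + 1 = 2 then (1 : L) else 0)).Local v × (UnitaryGroup.cmDatum L 1 (Matrix.of fun i j : Fin 1 => if i.val + j.val + 1 = 1 then (1 : L) else 0)).Local v)))]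
    [∀ a : ((UnitaryGroup.cmDatum L 2 (Matrix.of fun i j : Fin 2 => if i.val + j.val + 1 = 2 then (1 : L) else 0)).Local v × (UnitaryGroup.cmDatum L 1 (Matrix.of fun i j : Fin 1 => if i.val + j.val + 1 = 1 then (1 : L) else 0)).Local v), BorelSpace (((UnitaryGroup.cmDatum L 2 (Matrix.of fun i j : Fin 2 => if i.val + j.val + 1 = 2 then (1 : L) else 0)).Local v × (UnitaryGroup.cmDatum L 1 (Matrix.of fun i j : Fin 1 => if i.val + j.val + 1 = 1 then (1 : L) else 0)).Local v) ⧸ Subgroup.centralizer ({a} : Set ((UnitaryGroup.cmDatum L 2 (Matrix.of fun i j : Fin 2 => if i.val + j.val + 1 = 2 then (1 : L) else 0)).Local v × (UnitaryGroup.cmDatum L 1 (Matrix.of fun i j : Fin 1 => if i.val + j.val + 1 = 1 then (1 : L) else 0)).Local v)))]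
    (mH : OrbitalMeasureFamily ((UnitaryGroup.cmDatum L 2 (Matrix.of fun i j : Fin 2 => if i.val + j.val + 1 = 2 then (1 : L) else 0)).Local v × (UnitaryGroup.cmDatum L 1 (Matrix.of fun i j : Fin 1 => if i.val + j.val + 1 = 1 then (1 : L) else 0)).Local v)) (hmH : mH.IsCanonical (IsLocalGRegular L v) νH)
    (g : ((UnitaryGroup.cmDatum L 2 (Matrix.of fun i j : Fin 2 => if i.val + j.val + 1 = 2 then (1 : L) else 0)).Local v × (UnitaryGroup.cmDatum L 1 (Matrix.of fun i j : Fin 1 => if i.val + j.val + 1 = 1 then (1 : L) else 0)).Local v) → ℂ) (hg : IsLocSmooth g)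
    (h0 : ∀ a : ((UnitaryGroup.cmDatum L 2 (Matrix.of fun i j : Fin 2 => if i.val + j.val + 1 = 2 then (1 : L) else 0)).Local v × (UnitaryGroup.cmDatum L 1 (Matrix.of fun i j : Fin 1 => if i.val + j.val + 1 = 1 then (1 : L) else 0)).Local v), IsLocalGRegular L v a → classOrbitalIntegral mH g (ConjClasses.mk a) = 0) :
    ∫ h, g h ∂νH = 0 :=
  integral_eq_zero_of_forall_classOrbitalIntegral_eq_zero_of_conull L v hs νH mH hmH
    (measure_compl_setOf_isLocalGRegular_eq_zero L v hs νH) g hg h0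

end CMH

end Literature.NumberTheory.Rogawski1990

end
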